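import Summits.Schanuel.Schanuel.Theorems.ZilberEacComplexPerturbedCore
import HarnessLib

/-!
# Brownawell–Masser with an exponentially small moving perturbation (localized driver)

The driver of the tree's proof of Brownawell–Masser 2017 Prop. 2
(`Literature.NumberTheory.Transcendental.BrownawellMasser2017_dominantProjection_holds`, Masser's
Newton argument as in D'Aquino–Fornasiero–Terzo 2018 §2), re-run (i) for a caller-chosen generic
lattice direction `q`, (ii) with the solutions localized in the balls `B(2πi m q, ρ m)`, and (iii)
with an additional holomorphic perturbation `G`, `‖G‖ ≤ (64(n+1) e K mᴺ)⁻¹`, of the target: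
`e^{xⱼ} - Gⱼ(x)` in place of `e^{xⱼ}`. This is the "missing lemma L1" of the EC₃,₂ rung census.
-/

noncomputable section

open Complex MvPolynomial Metric Set Filter Topology
open Literature.NumberTheory.Transcendental Literature.NumberTheory.Transcendental.ExpDominant
open Literature.NumberTheory.Transcendental.HypersurfaceCover (spec)

set_option linter.dupNamespace false

namespace Summit.Schanuel.Schanuel.Theorems
variable {n : ℕ}

/-- **Localized Brownawell–Masser with an exponentially small moving perturbation** (the driver;
cf. `Literature.NumberTheory.Transcendental.BrownawellMasser2017_dominantProjection_holds`, whose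
proof — Masser's Newton argument after D'Aquino–Fornasiero–Terzo 2018 §2 — is re-run here). Let
`W ⊆ ℂⁿ × ℂⁿ` be irreducible Zariski closed of dimension `n` whose torus part projects dominantly to
`ℂⁿ`. Then there is a non-zero polynomial `Q` ("bad directions") such that for every lattice
direction `v = 2πi q`, `q ∈ ℤⁿ` with `Q(v) ≠ 0`, and every `ρ₀ > 0`, there are `0 < ρ ≤ ρ₀`,
`K ≥ 1`, `N` and `m₁` with: for all integers `m ≥ m₁` and all holomorphic `G` on the ball
`B(m v, ρ m)` with `‖Gⱼ‖ ≤ (64 (n+1) e K m^N)⁻¹` there, some `x ∈ B(m v, ρ m)` has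
`(x, (e^{xⱼ} - Gⱼ(x))ⱼ) ∈ W`. (With `G = 0` this is Brownawell–Masser 2017 Prop. 2 with the
localisation near lattice points that their proof gives.)
[cite: BrownawellMasser2017, Prop. 2 (p. 448)] -/
theorem exists_localized_perturbed_of_dominant (W : Set (Fin n ⊕ Fin n → ℂ))
    (hW : IsIrreducibleClosed ℂ W) (hdim : zariskiDim ℂ W = n)
    (hdom : HasDominantAddProjection ℂ (W ∩ torusLocus ℂ n)) :
    ∃ Q : MvPolynomial (Fin n) ℂ, Q ≠ 0 ∧ ∀ q : Fin n → ℤ,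
      eval (fun i => 2 * Real.pi * Complex.I * (q i : ℂ)) Q ≠ 0 → ∀ ρ₀ : ℝ, 0 < ρ₀ →
      ∃ ρ : ℝ, 0 < ρ ∧ ρ ≤ ρ₀ ∧ ∃ K : ℝ, 1 ≤ K ∧ ∃ Nn : ℕ, ∃ m₁ : ℕ, ∀ m : ℕ, m₁ ≤ m →
        1 ≤ m ∧ ∀ G : Fin n → (Fin n → ℂ) → ℂ,
        (∀ j, DifferentiableOn ℂ (G j)
          (ball ((m : ℂ) • fun i => 2 * Real.pi * Complex.I * (q i : ℂ)) (ρ * m))) →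
        (∀ j, ∀ z ∈ ball ((m : ℂ) • fun i => 2 * Real.pi * Complex.I * (q i : ℂ)) (ρ * m),
          ‖G j z‖ ≤ (64 * (n + 1) * (Real.exp 1 * K * (m : ℝ) ^ Nn))⁻¹) →
        ∃ x ∈ ball ((m : ℂ) • fun i => 2 * Real.pi * Complex.I * (q i : ℂ)) (ρ * m),
          (Sum.elim x (fun j => Complex.exp (x j) - G j x) : Fin n ⊕ Fin n → ℂ) ∈ W := by
  classical
  -- ### Step 0: `W = Z(P)` for the prime `P = I(W)`
  obtain ⟨⟨I, hWI⟩, hprime⟩ := hW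
  haveI : (vanishingIdeal ℂ W).IsPrime := hprime
  have hWP : W = zeroLocus ℂ (vanishingIdeal ℂ W) := by
    refine le_antisymm (zeroLocus_vanishingIdeal_le W) ?_
    rw [hWI]
    exact zeroLocus_anti_mono (le_vanishingIdeal_zeroLocus I)
  have hdimP : ringKrullDim (zeroLocusCoordRing (vanishingIdeal ℂ W)) = n := hdim
  have hdomP : ∀ q : MvPolynomial (Fin n) ℂ, rename Sum.inl q ∈ vanishingIdeal ℂ W → q = 0 := by
    intro q hq
    refine hdom q fun z hz => ?_
    have h := (mem_vanishingIdeal_iff.mp hq) z hz.1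
    rwa [aeval_rename] at h
  have hneW : (W ∩ torusLocus ℂ n).Nonempty := hdom.nonempty
  have hne : (zeroLocus ℂ (vanishingIdeal ℂ W) ∩ torusLocus ℂ n).Nonempty := hWP ▸ hneW
  have hY : ∀ j, (X (Sum.inr j) : MvPolynomial (Fin n ⊕ Fin n) ℂ) ∉ vanishingIdeal ℂ W :=
    X_inr_notMem_of_nonempty _ hne
  -- ### Step 1: the hypersurface model
  obtain ⟨F, g, N, c, p, hFm, hFdeg, hg0, hsep, hcne, hmem, hp0, hprel⟩ :=
    exists_model (vanishingIdeal ℂ W) hdimP hdomP hY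
  -- ### Step 2: the polynomial of bad directions
  have hpne : ∀ j, p j ≠ 0 := fun j h => hp0 j (by rw [h, Polynomial.coeff_zero])
  set topOf : MvPolynomial (Fin n) ℂ → MvPolynomial (Fin n) ℂ := fun a =>
    homogeneousComponent a.totalDegree a with htopOf
  set Q : MvPolynomial (Fin n) ℂ :=
    topOf g * ∏ j, (topOf ((p j).coeff 0) * topOf (p j).leadingCoeff) with hQ
  have hQ0 : Q ≠ 0 := by
    refine mul_ne_zero (homogeneousComponent_totalDegree_ne_zero hg0)
      (Finset.prod_ne_zero_iff.mpr fun j _ => mul_ne_zero ?_ ?_)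
    · exact homogeneousComponent_totalDegree_ne_zero (hp0 j)
    · exact homogeneousComponent_totalDegree_ne_zero (Polynomial.leadingCoeff_ne_zero.mpr (hpne j))
  refine ⟨Q, hQ0, fun qv hqv ρ₀ hρ₀ => ?_⟩
  set v : Fin n → ℂ := fun i => 2 * Real.pi * Complex.I * (qv i : ℂ) with hv
  have hvQ : eval v Q ≠ 0 := hqv
  rw [hQ, map_mul, map_prod] at hvQ
  have hvg : eval v (topOf g) ≠ 0 := left_ne_zero_of_mul hvQ
  have hvprod := right_ne_zero_of_mul hvQ
  have hv0 : ∀ j, eval v (topOf ((p j).coeff 0)) ≠ 0 := fun j => by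
    have := Finset.prod_ne_zero_iff.mp hvprod j (Finset.mem_univ j)
    rw [map_mul] at this
    exact left_ne_zero_of_mul this
  have hvd : ∀ j, eval v (topOf (p j).leadingCoeff) ≠ 0 := fun j => by
    have := Finset.prod_ne_zero_iff.mp hvprod j (Finset.mem_univ j)
    rw [map_mul] at this
    exact right_ne_zero_of_mul this
  -- ### Step 3: uniform thresholds along the ray `t v`
  obtain ⟨ρg, hρg, tg, htg, Kg, -, Ng, Hg⟩ :=
    exists_root_bounds (Polynomial.C g) v (by simpa [htopOf] using hvg) (by simpa [htopOf] using hvg)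
  have HJ := fun j => exists_root_bounds (p j) v (hv0 j) (hvd j)
  choose ρJ hρJ tJ htJ KJ hKJ NJ HJ using HJ
  set ρ : ℝ := min ρ₀ (min 1 ρg * ∏ j, min 1 (ρJ j)) with hρ
  have hρpos : 0 < ρ :=
    lt_min hρ₀ (mul_pos (lt_min one_pos hρg) (Finset.prod_pos fun j _ => lt_min one_pos (hρJ j)))
  have hρρ₀ : ρ ≤ ρ₀ := min_le_left _ _
  have hprod_le_one : ∏ j, min 1 (ρJ j) ≤ 1 :=
    Finset.prod_le_one (fun j _ => (lt_min one_pos (hρJ j)).le) fun j _ => min_le_left _ _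
  have hρg' : ρ ≤ ρg := by
    calc ρ ≤ min 1 ρg * ∏ j, min 1 (ρJ j) := min_le_right _ _
      _ ≤ min 1 ρg * 1 := mul_le_mul_of_nonneg_left hprod_le_one (le_min zero_le_one hρg.le)
      _ ≤ ρg := by rw [mul_one]; exact min_le_right _ _
  have hρJ' : ∀ j, ρ ≤ ρJ j := by
    intro j
    have h1 : ∏ j', min 1 (ρJ j') ≤ min 1 (ρJ j) := by
      rw [← Finset.mul_prod_erase Finset.univ (fun j' => min 1 (ρJ j')) (Finset.mem_univ j)]
      refine mul_le_of_le_one_right (le_min zero_le_one (hρJ j).le) ?_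
      exact Finset.prod_le_one (fun j' _ => (lt_min one_pos (hρJ j')).le) fun j' _ => min_le_left _ _
    calc ρ ≤ min 1 ρg * ∏ j, min 1 (ρJ j) := min_le_right _ _
      _ ≤ 1 * min 1 (ρJ j) :=
          mul_le_mul (min_le_left _ _) h1 (Finset.prod_nonneg fun j' _ =>
            (lt_min one_pos (hρJ j')).le) zero_le_one
      _ ≤ ρJ j := by rw [one_mul]; exact min_le_right _ _
  set T₀ : ℝ := tg + ∑ j, tJ j with hT₀
  have hT₀g : tg ≤ T₀ := by
    rw [hT₀]; exact le_add_of_nonneg_right (Finset.sum_nonneg fun j _ => zero_le_one.trans (htJ j))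
  have hT₀J : ∀ j, tJ j ≤ T₀ := fun j => by
    rw [hT₀]
    have h1 : tJ j ≤ ∑ j', tJ j' :=
      Finset.single_le_sum (fun j' _ => zero_le_one.trans (htJ j')) (Finset.mem_univ j)
    linarith [zero_le_one.trans htg]
  have hT₀1 : 1 ≤ T₀ := htg.trans hT₀g
  set K : ℝ := 1 + ∑ j, KJ j with hK
  have hK1 : 1 ≤ K := by
    rw [hK]; exact le_add_of_nonneg_right (Finset.sum_nonneg fun j _ => zero_le_one.trans (hKJ j))
  have hKJ' : ∀ j, KJ j ≤ K := fun j => by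
    rw [hK]
    have := Finset.single_le_sum (fun j' _ => zero_le_one.trans (hKJ j')) (Finset.mem_univ j)
    linarith
  set Nn : ℕ := ∑ j, NJ j with hNn
  have hNJ' : ∀ j, NJ j ≤ Nn := fun j =>
    Finset.single_le_sum (fun j' _ => Nat.zero_le _) (Finset.mem_univ j)
  have hgood : ∀ t : ℝ, T₀ ≤ t → ∀ x : Fin n → ℂ, ‖x - (t : ℂ) • v‖ ≤ ρ * t →
      eval x g ≠ 0 ∧ ∀ j (yy : ℂ), (spec (p j) x).IsRoot yy →
        yy ≠ 0 ∧ |Real.log ‖yy‖| ≤ Real.log K + Nn * Real.log t := by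
    intro t ht x hx
    have ht1 : 1 ≤ t := hT₀1.trans ht
    have ht0 : 0 ≤ t := zero_le_one.trans ht1
    refine ⟨?_, fun j yy hyy => ?_⟩
    · have := (Hg t (hT₀g.trans ht) x (hx.trans (mul_le_mul_of_nonneg_right hρg' ht0))).1.1
      simpa using this
    · obtain ⟨-, hb⟩ := HJ j t ((hT₀J j).trans ht) x (hx.trans (mul_le_mul_of_nonneg_right (hρJ' j) ht0))
      obtain ⟨hup, hlow⟩ := hb yy hyy
      have hmono : KJ j * t ^ NJ j ≤ K * t ^ Nn :=
        mul_le_mul (hKJ' j) (pow_le_pow_right₀ ht1 (hNJ' j)) (by positivity) (zero_le_one.trans hK1)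
      have hup' : ‖yy‖ ≤ K * t ^ Nn := hup.trans hmono
      have hlow' : (K * t ^ Nn)⁻¹ ≤ ‖yy‖ :=
        le_trans (inv_anti₀ (by have := hKJ j; positivity) hmono) hlow
      have hpos : 0 < ‖yy‖ := lt_of_lt_of_le (by positivity) hlow'
      exact ⟨norm_pos_iff.mp hpos, abs_log_norm_le hK1 ht1 hlow' hup'⟩
  -- ### Step 4: the threshold in `m`
  set ε : ℝ := 1 / (32 * (n + 1)) with hε
  have hεpos : 0 < ε := by positivity
  have hε1 : ε ≤ 1 := by
    rw [hε, div_le_one (by positivity)]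
    have : (0 : ℝ) ≤ n := Nat.cast_nonneg n
    linarith
  set A : ℝ := Real.log K + Real.pi + 3 with hA
  have hA3 : Real.pi + 3 ≤ A := by
    have := Real.log_nonneg hK1
    rw [hA]; linarith
  have hlim : Tendsto (fun t : ℝ => 18 * A ^ 2 * t⁻¹ + 18 * (Nn : ℝ) ^ 2 *
      (Real.log t ^ 2 / (1 * t + 0))) atTop (𝓝 0) := by
    have h1 : Tendsto (fun t : ℝ => 18 * A ^ 2 * t⁻¹) atTop (𝓝 0) := by
      have := tendsto_inv_atTop_zero.const_mul (18 * A ^ 2)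
      rwa [mul_zero] at this
    have h2 : Tendsto (fun t : ℝ => 18 * (Nn : ℝ) ^ 2 * (Real.log t ^ 2 / (1 * t + 0))) atTop
        (𝓝 0) := by
      simpa using (Real.tendsto_pow_log_div_mul_add_atTop 1 0 2 one_ne_zero).const_mul
        (18 * (Nn : ℝ) ^ 2)
    simpa using h1.add h2
  have hev : ∀ᶠ t : ℝ in atTop, 18 * A ^ 2 * t⁻¹ + 18 * (Nn : ℝ) ^ 2 *
      (Real.log t ^ 2 / (1 * t + 0)) < ε * ρ := hlim.eventually (gt_mem_nhds (by positivity))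
  have hevN : ∀ᶠ m : ℕ in atTop, T₀ ≤ (m : ℝ) ∧ 18 * A ^ 2 * (m : ℝ)⁻¹ + 18 * (Nn : ℝ) ^ 2 *
      (Real.log m ^ 2 / (1 * (m : ℝ) + 0)) < ε * ρ :=
    tendsto_natCast_atTop_atTop.eventually ((eventually_ge_atTop T₀).and hev)
  obtain ⟨m₁, hm₁⟩ := eventually_atTop.1 hevN
  refine ⟨ρ, hρpos, hρρ₀, K, hK1, Nn, m₁, fun m hm => ?_⟩
  obtain ⟨hmT, hmε⟩ := hm₁ m hm
  set t : ℝ := (m : ℝ) with ht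
  have ht1 : 1 ≤ t := hT₀1.trans hmT
  have hm1 : 1 ≤ m := by
    have ht1' := ht1
    rw [ht] at ht1'
    exact_mod_cast ht1'
  refine ⟨hm1, fun G hGd hGb => ?_⟩
  have htpos : 0 < t := by linarith
  have hlogt : 0 ≤ Real.log t := Real.log_nonneg ht1
  have hmain : 18 * A ^ 2 + 18 * (Nn : ℝ) ^ 2 * Real.log t ^ 2 < ε * ρ * t := by
    have h := mul_lt_mul_of_pos_right hmε htpos
    rw [one_mul, add_zero] at h
    have e1 : (18 * A ^ 2 * t⁻¹ + 18 * (Nn : ℝ) ^ 2 * (Real.log t ^ 2 / t)) * t =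
        18 * A ^ 2 + 18 * (Nn : ℝ) ^ 2 * Real.log t ^ 2 := by
      field_simp
    rw [e1] at h
    linarith
  obtain ⟨hrlt, hsmall⟩ := radius_admissible hA3 (Nat.cast_nonneg Nn) hεpos hε1 hρpos ht1 hlogt hmain
  set M : ℝ := Real.log K + Nn * Real.log t + 1 with hM
  have hM0 : 0 < M := by
    have := Real.log_nonneg hK1
    have : 0 ≤ (Nn : ℝ) * Real.log t := mul_nonneg (Nat.cast_nonneg _) hlogt
    rw [hM]; linarith
  have hrM : A + Nn * Real.log t = M + Real.pi + 2 := by rw [hA, hM]; ring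
  have hrM' : A + Nn * Real.log t - Real.pi - 2 = M := by rw [hA, hM]; ring
  rw [hrM', hrM] at hsmall
  rw [hrM] at hrlt
  set tv : Fin n → ℂ := (t : ℂ) • v with htv
  have htv1 : ∀ j, Complex.exp (tv j) = 1 := by
    intro j
    have : tv j = ((m * qv j : ℤ) : ℂ) * (2 * Real.pi * Complex.I) := by
      simp only [htv, hv, ht, Pi.smul_apply, smul_eq_mul]
      push_cast
      ring
    rw [this]
    exact Complex.exp_int_mul_two_pi_mul_I _
  have htvm : ((m : ℂ) • v) = tv := by rw [htv, ht, Complex.ofReal_natCast]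
  have hball_le : ∀ z ∈ closedBall tv (ρ * t), ‖z - (t : ℂ) • v‖ ≤ ρ * t := fun z hz => by
    rwa [mem_closedBall, dist_eq_norm] at hz
  have hsep' : ∀ z ∈ closedBall tv (ρ * t), (spec F z).Separable := fun z hz =>
    hsep z (hgood t hmT z (hball_le z hz)).1
  have hg' : ∀ z ∈ closedBall tv (ρ * t), eval z g ≠ 0 := fun z hz =>
    (hgood t hmT z (hball_le z hz)).1
  have hroots : ∀ z ∈ ball tv (ρ * t), ∀ j, ∀ yy : ℂ, (spec (p j) z).IsRoot yy →
      yy ≠ 0 ∧ |Real.log ‖yy‖| ≤ M := by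
    intro z hz j yy hyy
    obtain ⟨h1, h2⟩ := (hgood t hmT z (hball_le z (ball_subset_closedBall hz))).2 j yy hyy
    exact ⟨h1, h2.trans (by rw [hM]; linarith)⟩
  -- the perturbation bound `η e^M ≤ 1/(64(n+1))`
  have hexpM : Real.exp M = Real.exp 1 * K * t ^ Nn := by
    rw [hM, Real.exp_add, Real.exp_add, Real.exp_log (by linarith), Real.exp_nat_mul,
      Real.exp_log htpos]
    ring
  have hη : (64 * (n + 1) * (Real.exp 1 * K * (m : ℝ) ^ Nn))⁻¹ * Real.exp M ≤
      1 / (64 * (n + 1)) := by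
    rw [hexpM, ← ht]
    have hpos : 0 < Real.exp 1 * K * t ^ Nn := by positivity
    rw [mul_inv, mul_assoc, inv_mul_cancel₀ hpos.ne', mul_one, one_div]
  have hballeq : ball ((m : ℂ) • v) (ρ * (m : ℝ)) = ball tv (ρ * t) := by rw [htvm, ht]
  have hGd' : ∀ j, DifferentiableOn ℂ (G j) (ball tv (ρ * t)) := fun j => by
    rw [← hballeq]; exact hGd j
  have hGb' : ∀ j, ∀ z ∈ ball tv (ρ * t),
      ‖G j z‖ ≤ (64 * (n + 1) * (Real.exp 1 * K * (m : ℝ) ^ Nn))⁻¹ := fun j z hz => by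
    refine hGb j z ?_
    rw [hballeq]; exact hz
  -- ### Step 5: the perturbed analytic core
  obtain ⟨x, hxball, hx⟩ := exists_expPoint_near_add (vanishingIdeal ℂ W) hFm hFdeg N g c p
    hcne hmem hprel tv htv1 hM0 hsep' hg' hroots hrlt hsmall G hGd' hGb' hη
  refine ⟨x, ?_, ?_⟩
  · rw [hballeq]; exact hxball
  · rw [hWP]; exact hx

end Summit.Schanuel.Schanuel.Theorems
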